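import Summits.RiemannHypothesis.RiemannHypothesis.Theorems.TiltedLandingLaw421R3Lens1CoverageRS2

/-!
# Lens-1 file SHAPE v3 ((CA494)/(CA500)/(CA508) O2, lineage currency): the SHADOW COVER of an uncuttable level and the assembled A3′ object

Per (CA506)/(CA508): the (3i″) module of record `…R3Lens1CoverageRS2` (= `lens-1/CoverageRS2-v2.lean` 7915e94a) already lands
`RhW08.Lens1Coverage.inhabitant_shape`; this module CITES it (no restatement) and adds the shadow-cover theorems.  Imports `…R3Lens1CoverageRS2`
only; namespace `RhW08.Lens1Shape`; landable after (3i″), OUTSIDE the v10q chain → proposed `…/Theorems/TiltedLandingLaw421R3Lens1Shape.lean`.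
CHECK STATUS (v4 = v3 with ONE token changed, l.68: the landed `…R3Lens1SignCut` keeps `neg_of_pos_mul_neg` PRIVATE, so v3 cannot see it; v4 uses Mathlib `neg_of_mul_neg_right h1 hy.le`): cannot elaborate by import until `…R3Lens1CoverageRS2` is built; the inline probe `lens-1/Shape-v4-probe.lean` (landed R + landed S #1143 IMPORTED +
RS v1 + RS2 v2 bodies + this body) gives farm rc 0 · 0 warnings · 0 sorry · `a3_object` axioms = [propext, Classical.choice, Quot.sound].
CONTENT: `Shadowed f Hs i x` (the vertical through `x` meets, at a height `≤ Hs`, the CLOSED Jensen disc of a non-real zero of `f^{(i)}`),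
`BadFoot f i x` (`f^{(i)}(x) = 0 ∨ f^{(i)}′(x) = 0`), ★ `shadowCover_of_not_cuttable` («level `i` not column-cuttable» UNFOLDED: some column couple
has one WHOLE column side made of bad feet and shadowed abscissae — contrapositive of `sgn_of_jensenClear`, Kim 1996 (2.3)), ★ `a3_object`
(= `RhW08.Lens1Coverage.inhabitant_shape` ∧ the shadow cover at the first uncuttable level `i₀`: A3′'s «column couple edge-connected to a wall» as a
kernel object).  0 sorry.  Nothing here bears on the truth of RH; RH is not proved; ⟨33346⟩/⟨33347⟩ stay OPEN. -/

namespace RhW08.Lens1Shape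

set_option linter.dupNamespace false

open Complex Set
open scoped ComplexConjugate
open Literature.Analysis.Complex
open Summit.RiemannHypothesis.RiemannHypothesis.Theorems.Splittings.JensenWindow
open RhIdea6.G17.W07C7 RhIdea6.G17.W07C7.Rev6 RhIdea6.G18.W07C8.Law421BirthS RhIdea6.G19.W07C11.Seam
open RhIdea6.G20.W07C12.Frac RhIdea6.G20.W07C12.StColP RhW07.C12.FieldSplit RhIdea6.G21.W07C13.TentMax
open RhW07.C14.TwoSided RhW07.C14.Classes RhW07.C14.Lineage RhW07.C14.Booking
open RhW07.C13.Heredity RhIdea6.G22.W07C15pre.Injection RhW07.E3.Cell RhW07.E3.Lit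
open RhW08.Round1 RhW08.StSwap RhW08.Round2 RhW08.QuadW RhW08.SealSwapQ RhW08.SealSwap RhW08.SuccB RhW08.SuccSplit
open RhW08.SuccTheft RhW08.Column RhW08.Hurwitz RhW08.ClusterQ RhW08.ClusterQM RhW08.NewtonDoor RhW08.NewtonDoorGenusOne RhW08.PurseP
open RhW08.AntiEscapeSplit7

open RhW08.Lens1SignCut
open RhW08.Lens1Coverage

/-- `x` is SHADOWED at level `i` (below height `Hs`): some point of the vertical through `x` at a height `y ∈ (0, Hs]` lies in the CLOSED Jensen
disc of a non-real zero `a` of `f^{(i)}` (`(x − Re a)² + y² ≤ Im a²`, so `|x − Re a| < |Im a|`). -/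
def Shadowed (f : ℂ → ℂ) (Hs : ℝ) (i : ℕ) (x : ℝ) : Prop :=
  ∃ y ∈ Ioc (0 : ℝ) Hs, ¬ JensenClear (iteratedDeriv i f) ((x : ℂ) + (y : ℂ) * I)

/-- `x` is a BAD FOOT at level `i`: `f^{(i)}(x) = 0` or `f^{(i+1)}(x) = 0` (a discrete set of exceptions). -/
def BadFoot (f : ℂ → ℂ) (i : ℕ) (x : ℝ) : Prop :=
  iteratedDeriv i f x = 0 ∨ deriv (iteratedDeriv i f) x = 0

/-- ★ SHADOW COVER (the kernel meaning of «edge-connected», proved): on a legal frame, if level `i` is NOT column-cuttable then some column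
couple `c` of `f^{(i)}` has ONE WHOLE SIDE of the closed column — every `α ∈ [x₀ − R/2, Re c)` or every `β ∈ (Re c, x₀ + R/2]` — consisting of
bad feet and SHADOWED abscissae only: every vertical there meets, at some height `≤ Hs`, the closed Jensen disc of a non-real zero of `f^{(i)}`
(contrapositive of `sgn_of_jensenClear`, Kim 1996 (2.3): a Jensen-clear vertical with good feet is a signed transversal).  So the A3′ object is a
chain of Jensen discs of zeros of `f^{(i₀)}` at heights `≤ Hs` joining the column couple to a column wall. -/
theorem shadowCover_of_not_cuttable {η : ℝ} {f : ℂ → ℂ} {x₀ s hmax R Hs : ℝ} {B : ℕ}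
    (hE : EngineHyps5 2 η f x₀ s hmax R Hs B) (i : ℕ) (hnc : ¬ ColumnCuttable f x₀ R Hs i) :
    ∃ c : ℂ, iteratedDeriv i f c = 0 ∧ c.im ≠ 0 ∧ |c.re - x₀| < R / 2 ∧
      ((∀ α : ℝ, x₀ - R / 2 ≤ α → α < c.re → BadFoot f i α ∨ Shadowed f Hs i α) ∨
       (∀ β : ℝ, c.re < β → β ≤ x₀ + R / 2 → BadFoot f i β ∨ Shadowed f Hs i β)) := by
  by_contra H
  apply hnc
  intro c hc hcim hcre
  have H' : ¬ ((∀ α : ℝ, x₀ - R / 2 ≤ α → α < c.re → BadFoot f i α ∨ Shadowed f Hs i α) ∨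
      (∀ β : ℝ, c.re < β → β ≤ x₀ + R / 2 → BadFoot f i β ∨ Shadowed f Hs i β)) := fun h => H ⟨c, hc, hcim, hcre, h⟩
  push Not at H'
  obtain ⟨⟨α, hα1, hα2, hαF, hαS⟩, ⟨β, hβ1, hβ2, hβF, hβS⟩⟩ := H'
  have imS : ∀ a y : ℝ, ((a : ℂ) + (y : ℂ) * I).im = y := by intro a y; simp
  have sgn : ∀ a y : ℝ, 0 < y → JensenClear (iteratedDeriv i f) ((a : ℂ) + (y : ℂ) * I) →
      (deriv (iteratedDeriv i f) ((a : ℂ) + (y : ℂ) * I) / iteratedDeriv i f ((a : ℂ) + (y : ℂ) * I)).im < 0 := by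
    intro a y hy hcl
    have h1 := sgn_of_jensenClear (realEntireLt2_of_hyps hE) i ⟨c, hc⟩ (w := (a : ℂ) + (y : ℂ) * I) (by rw [imS]; exact hy.ne') hcl
    rw [imS] at h1
    exact neg_of_mul_neg_right h1 hy.le
  have clα : ∀ y ∈ Ioc (0 : ℝ) Hs, JensenClear (iteratedDeriv i f) ((α : ℂ) + (y : ℂ) * I) := fun y hy => by
    by_contra h; exact hαS ⟨y, hy, h⟩
  have clβ : ∀ y ∈ Ioc (0 : ℝ) Hs, JensenClear (iteratedDeriv i f) ((β : ℂ) + (y : ℂ) * I) := fun y hy => by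
    by_contra h; exact hβS ⟨y, hy, h⟩
  unfold BadFoot at hαF hβF
  exact ⟨α, β, hα1, hβ2, hα2, hβ1, (not_or.mp hαF).1, (not_or.mp hβF).1, (not_or.mp hαF).2, (not_or.mp hβF).2,
    fun y hy => sgn α y hy.1 (clα y hy), fun y hy => sgn β y hy.1 (clβ y hy)⟩

/-- ★ THE A3′ OBJECT, assembled (proved): a hyps-inhabitant of the lineage binder at a non-`ReadyR2` level `j` yields a first uncuttable level
`i₀ ≤ j` (lower levels cuttable, a column couple at every level `≤ i₀`) together with a level-`i₀` column couple one of whose column sides is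
shadow-covered (bad feet ∪ Jensen shadows at heights `≤ Hs`). -/
theorem a3_object {η : ℝ} {f : ℂ → ℂ} {x₀ s hmax R Hs : ℝ} {B j : ℕ} (v : ℂ)
    (hE : EngineHyps5 2 η f x₀ s hmax R Hs B) (hnR : ¬ ReadyR2 η f x₀ s hmax R Hs B j v)
    (h : ∃ i : ℕ, i ≤ j ∧ ¬ ColumnCuttable f x₀ R Hs i) :
    ∃ i₀ : ℕ, i₀ ≤ j ∧ (∀ i : ℕ, i < i₀ → ColumnCuttable f x₀ R Hs i) ∧ (∀ k : ℕ, k ≤ i₀ → ColCouple f x₀ R k) ∧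
      ∃ c : ℂ, iteratedDeriv i₀ f c = 0 ∧ c.im ≠ 0 ∧ |c.re - x₀| < R / 2 ∧
        ((∀ α : ℝ, x₀ - R / 2 ≤ α → α < c.re → BadFoot f i₀ α ∨ Shadowed f Hs i₀ α) ∨
         (∀ β : ℝ, c.re < β → β ≤ x₀ + R / 2 → BadFoot f i₀ β ∨ Shadowed f Hs i₀ β)) := by
  obtain ⟨i₀, hi₀, hnc, hmin, hcc⟩ := RhW08.Lens1Coverage.inhabitant_shape v hE hnR h
  exact ⟨i₀, hi₀, hmin, hcc, shadowCover_of_not_cuttable hE i₀ hnc⟩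

end RhW08.Lens1Shape
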